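import Summits.QuantumFields.YangMills.Theorems.UnitScaleTiltProp7Lane2CutoffPackage
import Summits.QuantumFields.YangMills.Theorems.UnitScaleTiltProp7Lane2CutoffOps
import Summits.QuantumFields.YangMills.Theorems.UnitScaleTiltProp7LODCutoffRealFamily
import HarnessLib

/-!
# Route `UnitScaleTilt`, crux K1 «MinimiserStabilityRegPr» (stmt-QuantumFields-19200), EX row `hGF` (curved member), the LOD line (★p1 g24 `LOCATE-L6-ASSEMBLY` §1 Step I.1,
# v1.1 «CUTOFFS»; w5 g13 hazard flag + spec (χ1)–(χ4) of record, 2026-08-29 23:29Z) — **PEN (L6-χ): THE CUTOFF LETTERS.  A FINE-SMOOTH QUADRATIC PARTITION OF UNITY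
# `Σ_c χ_c² = 1` AT SCALE `L^s` BLOCKS WITH K-UNIFORM LIPSCHITZ ROWS, AND THE ZEROTH-ORDER COMMUTATOR ROWS OF `D_W`, `D*_W` WITH A REAL WEIGHT.**

Cell `ym3-torus` (HUMAN RULING D-0037: YM₃ on T³ is ladder rung R3 — NOT d = 4, NOT infinite volume, NOT a mass gap, NOT Clay).  Width seat `ym3-torus-px17` (gen 8);
pen handed over by px13 g12 23:40Z; memo `LOCATE-L6chi-px17g8.md` (19200 evidence).  THEOREMS ONLY (0 `def`, 0 `sorry`); `--supports stmt-QuantumFields-19200 --as helper`,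
count-neutral.  HONEST LABEL (№33 (6)): bookkeeping of cutoffs for the IMS localisation of the curved γ-row (LOD line Step I.1); no estimate of Bałaban's is asserted;
nothing of (L5x), (L6), `hGF`, `h349`, EX or the crux is proved here.

THE POINT (w5 g13's hazard flag).  The IMS step `T_U(A) ≥ Σ_j T_U(χ_jA) − e‖A‖²` needs `Σ_j χ_j² = 1` and, for the LOCAL second-order letters `Δ^η(U₀)`, `D D*`,
cutoffs that move by `O(η∕R′)` per FINE step (a block-constant `χ` jumps `1∕R′` across one fine bond at a block face ⟹ `[D,χ] ~ η⁻¹∕R′`, not K-uniform).  LANE II's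
brick (B6) already holds such a family as a LINEAR partition (✓`Prop7Lane2PartitionOfUnity.exists_partitionOfUnity`: `Σ_c ζ_c = 1`, `0 ≤ ζ ≤ 1`, alive count `≤ 8`,
support radius `L^s` blocks, per-fine-step increment `a = (3∕2)∕(L^s·L^{K−n})`), and the `D_W`∕`Δ_W` commutator rows (✓`Prop7Lane2CutoffCommutators`).  Here:
* FILE A ✓∕⧗`…Prop7LODCutoffRealFamily` (pure real algebra over a finite family): the SQUARES NORMALISATION `χ_c := ζ_c∕√N`, `N := Σ_c ζ_c² ∈ [1∕k, 1]` (`k` = alive count): `Σχ² = 1`, `0 ≤ χ ≤ 1`,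
  per index `|χ′_c − χ_c| ≤ (√k + k√k)·a`, family `Σ_c (χ′_c − χ_c)² ≤ (4k² + 2k³)·a²` — quadratic in `a`, so the currency survives;
* §B the GLOBAL zeroth-order commutator rows: ★`toL2S_symm_DstarL2_srcMul_sub_apply` (Leibniz for `D*_W` with a weight read at the source, EXACT from the stencil (3.8)),
  ★★`normSq_DstarL2_srcMul_sub_le` (`‖D*_W(ζ(b₋)•X)~ − (ζ•D*_WX̃)~‖² ≤ 3a²η⁻²‖X̃‖²`), ★★`normSq_DL2_siteMul_sub_le` (the ✓ `D`-row at `S = univ`);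
* §C ★★★`exists_sqPartition (s) (hnK : n < K) (hs : s < F.m + n)`: the quadratic partition at scale `L^s` blocks with ALL its rows — `0 ≤ χ ≤ 1`, `Σ_c χ_c(x)² = 1`,
  `χ_c = 0` off the centre set, support radius `< L^s·L^{K−n}` fine steps, alive `≤ 8`, per-fine-step `|∂χ_c| ≤ 27√2∕(L^s·L^{K−n})` and `Σ_c (∂χ_c)² ≤ 2880∕(L^s·L^{K−n})²`;
  ★★`normSq_comm_rows_of_readings`: for ANY linear `Zs, Zb` with the (Z2) readings of a weight with per-step bound `ℓ` (✓`Prop7Lane2CutoffOps.exists_cutoffOps_norm_le`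
  supplies them), `‖D_W(Zsφ) − Zb(D_Wφ)‖² ≤ 3ℓ²η⁻²‖φ‖²` and `‖D*_W(Zb f) − Zs(D*_W f)‖² ≤ 3ℓ²η⁻²‖f‖²`; with `ℓ = 27√2∕(L^s L^{K−n})` and `η·L^{K−n} = 1`:
  `3ℓ²η⁻² = 4374·L^{−2s}` — K-FREE (★`three_mul_sq_step_mul_inv_eta_sq`).
NOT HERE (v1.1 if a consumer names it): the `χ̄∘blk + δ` split for the `Q`-rows (`‖δ‖_∞ = O(L^{−s})` needs a block-diameter path letter), second differences of `χ`.

References: T. Bałaban, CMP **99** (1985) 389–434 [Balaban1985BackgroundPropagators] ((3.3), (3.8), (3.10)–(3.12) pp.391–392; (3.100) pp.413–414); CMP **96** (1984)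
223–250 [Balaban1984PropagatorsII] (§1, cutoffs of the block lattice); CMP **98** (1985) 17–51 [Balaban1985Averaging] ((5) p.18); B. Simon, Ann. IHP A **38** (1983) 295–308 (IMS).
-/

set_option autoImplicit false

noncomputable section

open scoped BigOperators Matrix.Norms.L2Operator Matrix

namespace Summit.QuantumFields.YangMills.Theorems.Prop7LODCutoffLetters

open Literature.MathematicalPhysics.QuantumFieldTheory.Balaban1983to89
open Literature.MathematicalPhysics.QuantumFieldTheory.Balaban1983to89.T3ContinuumYM3Torus
open T3SectALandauChart (bgUnits eta eta_pos)
open B10Eq27TorusAxialLog (unitsField toUField)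
open B10StarCount (shift_unshift unshift_shift)
open B9Eq39Adjoint (R R_def covDstar divB)
open B9TorusCalculus (torusT torusT_symm_apply)
open Summit.QuantumFields.YangMills.Theorems.Prop7SectET3HilbertLetters (W₂ toL2 toL2S DL2 DstarL2)
open Summit.QuantumFields.YangMills.Theorems.Prop7DivSliceOfMemberDivSq (toL2S_symm_DstarL2_toL2_eq)
open Summit.QuantumFields.YangMills.Theorems.Prop7LaplaceAFlatLetters (norm_sq_toL2 norm_sq_toL2S)
open Summit.QuantumFields.YangMills.Theorems.Prop7CovariantCoercivity (sum_norm_sq_R inv_mem_unitary)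
open Summit.QuantumFields.YangMills.Theorems.Prop7CovAgmonLetters (hs_smul)
open Summit.QuantumFields.YangMills.Theorems.Prop7Lane2CutoffCommutators (coe_bgUnits_mem_unitary' norm_sq_DL2_smul_sub_le)
open Summit.QuantumFields.YangMills.Theorems.Prop7Lane2CutoffFamilyRows (hs_sum_smul_le sum_weight_mul_le)
open Summit.QuantumFields.YangMills.Theorems.Prop7Lane2PartitionOfUnity (exists_partitionOfUnity)

open Summit.QuantumFields.YangMills.Theorems.Prop7LODCutoffRealFamily

/-! ## §B The commutator rows of `D_W` and `D*_W` with a real site weight, GLOBAL form -/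

section Member

variable (F : T3Family) {n K : ℕ} {c₀ : ℝ} [Fact (0 < c₀)]

omit [Fact (0 < c₀)] in
/-- **RE-INDEXING THE INCOMING BONDS**: `Σ_x Σ_μ f⟨x − e_μ, μ⟩ = Σ_b f(b)` (`b ↦ (b₊, μ(b))` is a bijection). [cite: Balaban1985Averaging, (5) p.18] -/
theorem sum_unshift_eq_sum_bond (f : PBond (F.P K) 0 → ℝ) :
    ∑ x : Site (F.P K) 0, ∑ μ : Fin (F.P K).d, f ⟨x.unshift μ, μ⟩ = ∑ b : PBond (F.P K) 0, f b := by
  let e : Site (F.P K) 0 × Fin (F.P K).d ≃ PBond (F.P K) 0 :=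
    ⟨fun p => ⟨p.1.unshift p.2, p.2⟩, fun b => (b.src.shift b.dir, b.dir),
      fun p => by simp only [shift_unshift], fun b => by simp only [unshift_shift]⟩
  rw [← Fintype.sum_equiv e (fun p => f ⟨p.1.unshift p.2, p.2⟩) f (fun _ => rfl), Fintype.sum_prod_type]

/-- ★ **LEIBNIZ FOR `D*_W` WITH A SCALAR READ AT THE SOURCE, POINTWISE**: `D*_W(ζ(b₋)•X)(x) − ζ(x)·(D*_WX)(x) = η⁻¹·Σ_μ (ζ(x − e_μ) − ζ(x))·Ad(W(b_μ)⁻¹)X(b_μ)`,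
`b_μ = ⟨x − e_μ, μ⟩` — in the stencil (3.8) the outgoing summand carries `ζ(x)` and cancels, the incoming one carries `ζ(x − e_μ)`.
[cite: Balaban1985BackgroundPropagators, (3.8) p.392] -/
theorem toL2S_symm_DstarL2_srcMul_sub_apply (W : GaugeField (F.P K) 0 (Matrix.specialUnitaryGroup (Fin 2) ℂ)) (ζ : Site (F.P K) 0 → ℝ)
    (X : PBond (F.P K) 0 → Matrix (Fin 2) (Fin 2) ℂ) (x : Site (F.P K) 0) :
    (toL2S F K c₀).symm (DstarL2 F n K c₀ W (toL2 F K c₀ (fun b => ζ b.src • X b))) x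
        - ζ x • (toL2S F K c₀).symm (DstarL2 F n K c₀ W (toL2 F K c₀ X)) x
      = (eta F n K)⁻¹ • ∑ μ : Fin (F.P K).d, (ζ (x.unshift μ) - ζ x) • R (bgUnits F K W ⟨x.unshift μ, μ⟩)⁻¹ (X ⟨x.unshift μ, μ⟩) := by
  have hbg : bgUnits F K W = unitsField (toUField W) := rfl
  rw [hbg, toL2S_symm_DstarL2_toL2_eq F n K c₀ W (fun b => ζ b.src • X b), toL2S_symm_DstarL2_toL2_eq F n K c₀ W X]
  beta_reduce
  rw [smul_comm (ζ x) ((eta F n K)⁻¹), ← smul_sub]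
  congr 1
  unfold divB
  rw [Finset.smul_sum, ← Finset.sum_sub_distrib]
  refine Finset.sum_congr rfl fun μ _ => ?_
  unfold covDstar
  rw [torusT_symm_apply]
  dsimp only
  rw [R_def, R_def, Matrix.mul_smul, Matrix.smul_mul, smul_sub, sub_smul]
  abel

/-- Real-arithmetic closer of the next proof. [folklore] -/
theorem chain_le_of_rows {L c Sg e ST a SX : ℝ} (hc : 0 ≤ c) (he : 0 ≤ e) (h1 : L = c * Sg) (h2 : Sg ≤ e * ST) (h3 : ST ≤ 3 * a ^ 2 * SX) :
    L ≤ 3 * a ^ 2 * e * (c * SX) := by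
  rw [h1]
  have h4 : c * Sg ≤ c * (e * (3 * a ^ 2 * SX)) := mul_le_mul_of_nonneg_left (h2.trans (mul_le_mul_of_nonneg_left h3 he)) hc
  calc c * Sg ≤ c * (e * (3 * a ^ 2 * SX)) := h4
    _ = 3 * a ^ 2 * e * (c * SX) := by ring

/-- ★★ **THE `D*`-COMMUTATOR ROW, GLOBAL**: if `|ζ(x + e_μ) − ζ(x)| ≤ a` for every fine step, then
`‖D*_W(ζ(b₋)•X)~ − (ζ•D*_WX̃)~‖² ≤ 3·a²·η⁻²·‖X̃‖²` (each bond met once, at its target; `Ad` unitary; Cauchy–Schwarz over the `3` directions).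
[cite: Balaban1985BackgroundPropagators, (3.8) p.392, (3.100) pp.413-414] -/
theorem normSq_DstarL2_srcMul_sub_le (W : GaugeField (F.P K) 0 (Matrix.specialUnitaryGroup (Fin 2) ℂ)) (ζ : Site (F.P K) 0 → ℝ)
    (X : PBond (F.P K) 0 → Matrix (Fin 2) (Fin 2) ℂ) {a : ℝ} (ha : ∀ (x : Site (F.P K) 0) (μ : Fin (F.P K).d), |ζ (x.shift μ) - ζ x| ≤ a) :
    ‖DstarL2 F n K c₀ W (toL2 F K c₀ (fun b => ζ b.src • X b))
        - toL2S F K c₀ (fun x => ζ x • (toL2S F K c₀).symm (DstarL2 F n K c₀ W (toL2 F K c₀ X)) x)‖ ^ 2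
      ≤ 3 * a ^ 2 * (eta F n K)⁻¹ ^ 2 * ‖toL2 F K c₀ X‖ ^ 2 := by
  have hc : 0 < c₀ := Fact.out
  have hd3 : (Fintype.card (Fin (F.P K).d) : ℝ) = 3 := by rw [Fintype.card_fin]; exact_mod_cast T3Family.P_d F K
  -- read the difference back on the sites
  obtain ⟨g, hg, hback⟩ : ∃ g : Site (F.P K) 0 → Matrix (Fin 2) (Fin 2) ℂ,
      g = (toL2S F K c₀).symm (DstarL2 F n K c₀ W (toL2 F K c₀ (fun b => ζ b.src • X b))
            - toL2S F K c₀ (fun x => ζ x • (toL2S F K c₀).symm (DstarL2 F n K c₀ W (toL2 F K c₀ X)) x)) ∧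
      DstarL2 F n K c₀ W (toL2 F K c₀ (fun b => ζ b.src • X b))
            - toL2S F K c₀ (fun x => ζ x • (toL2S F K c₀).symm (DstarL2 F n K c₀ W (toL2 F K c₀ X)) x) = toL2S F K c₀ g :=
    ⟨_, rfl, ((toL2S F K c₀).apply_symm_apply _).symm⟩
  have hgx : ∀ x, g x = (eta F n K)⁻¹ • ∑ μ : Fin (F.P K).d, (ζ (x.unshift μ) - ζ x) • R (bgUnits F K W ⟨x.unshift μ, μ⟩)⁻¹ (X ⟨x.unshift μ, μ⟩) := by
    intro x
    rw [hg, map_sub, Pi.sub_apply, LinearEquiv.symm_apply_apply]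
    exact toL2S_symm_DstarL2_srcMul_sub_apply F (n := n) (c₀ := c₀) W ζ X x
  -- the weights are `≤ a`
  have hw : ∀ (x : Site (F.P K) 0) (μ : Fin (F.P K).d), |ζ (x.unshift μ) - ζ x| ≤ a := by
    intro x μ
    have h := ha (x.unshift μ) μ
    rw [shift_unshift] at h
    rwa [abs_sub_comm] at h
  have ha0 : 0 ≤ a := (abs_nonneg _).trans (ha (0 : Site (F.P K) 0) ⟨0, by rw [T3Family.P_d]; omega⟩)
  -- sitewise weighted Cauchy–Schwarz over the three incoming bonds
  have hsite : ∀ x, ∑ j : Fin 2, ∑ k : Fin 2, ‖g x j k‖ ^ 2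
      ≤ (eta F n K)⁻¹ ^ 2 * (3 * a ^ 2 * ∑ μ : Fin (F.P K).d, ∑ j : Fin 2, ∑ k : Fin 2, ‖X ⟨x.unshift μ, μ⟩ j k‖ ^ 2) := by
    intro x
    rw [hgx x, hs_smul]
    refine mul_le_mul_of_nonneg_left ?_ (by positivity)
    have h1 := hs_sum_smul_le (N := 2) Finset.univ (fun μ : Fin (F.P K).d => ζ (x.unshift μ) - ζ x)
      (fun μ => R (bgUnits F K W ⟨x.unshift μ, μ⟩)⁻¹ (X ⟨x.unshift μ, μ⟩))
    have hsw : ∑ μ : Fin (F.P K).d, |ζ (x.unshift μ) - ζ x| ≤ 3 * a := by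
      calc ∑ μ : Fin (F.P K).d, |ζ (x.unshift μ) - ζ x| ≤ ∑ _μ : Fin (F.P K).d, a := Finset.sum_le_sum fun μ _ => hw x μ
        _ = 3 * a := by rw [Finset.sum_const, Finset.card_univ, nsmul_eq_mul, hd3]
    have h2 := sum_weight_mul_le Finset.univ (fun μ : Fin (F.P K).d => ζ (x.unshift μ) - ζ x)
      (fun μ => ∑ j : Fin 2, ∑ k : Fin 2, ‖(R (bgUnits F K W ⟨x.unshift μ, μ⟩)⁻¹ (X ⟨x.unshift μ, μ⟩)) j k‖ ^ 2)
      (fun μ _ => hw x μ) (fun μ _ => Finset.sum_nonneg fun _ _ => Finset.sum_nonneg fun _ _ => sq_nonneg _)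
    have hR : ∀ μ : Fin (F.P K).d, ∑ j : Fin 2, ∑ k : Fin 2, ‖(R (bgUnits F K W ⟨x.unshift μ, μ⟩)⁻¹ (X ⟨x.unshift μ, μ⟩)) j k‖ ^ 2
        = ∑ j : Fin 2, ∑ k : Fin 2, ‖X ⟨x.unshift μ, μ⟩ j k‖ ^ 2 := fun μ =>
      sum_norm_sq_R (inv_mem_unitary (coe_bgUnits_mem_unitary' F K W ⟨x.unshift μ, μ⟩)) _
    have h0 : 0 ≤ ∑ μ : Fin (F.P K).d, |ζ (x.unshift μ) - ζ x| *
        ∑ j : Fin 2, ∑ k : Fin 2, ‖(R (bgUnits F K W ⟨x.unshift μ, μ⟩)⁻¹ (X ⟨x.unshift μ, μ⟩)) j k‖ ^ 2 :=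
      Finset.sum_nonneg fun _ _ => mul_nonneg (abs_nonneg _) (Finset.sum_nonneg fun _ _ => Finset.sum_nonneg fun _ _ => sq_nonneg _)
    refine h1.trans ?_
    refine (mul_le_mul hsw h2 h0 (by positivity)).trans (le_of_eq ?_)
    rw [Finset.sum_congr rfl fun μ _ => hR μ]
    ring
  have hsum : ∑ x : Site (F.P K) 0, ∑ μ : Fin (F.P K).d, ∑ j : Fin 2, ∑ k : Fin 2, ‖X ⟨x.unshift μ, μ⟩ j k‖ ^ 2
      = ∑ b : PBond (F.P K) 0, ∑ j : Fin 2, ∑ k : Fin 2, ‖X b j k‖ ^ 2 :=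
    sum_unshift_eq_sum_bond F (fun b => ∑ j : Fin 2, ∑ k : Fin 2, ‖X b j k‖ ^ 2)
  have h1 : ‖DstarL2 F n K c₀ W (toL2 F K c₀ (fun b => ζ b.src • X b))
        - toL2S F K c₀ (fun x => ζ x • (toL2S F K c₀).symm (DstarL2 F n K c₀ W (toL2 F K c₀ X)) x)‖ ^ 2
      = c₀ * ∑ x, ∑ j : Fin 2, ∑ k : Fin 2, ‖g x j k‖ ^ 2 := by
    rw [hback]; exact norm_sq_toL2S g
  have h2 : ∑ x, ∑ j : Fin 2, ∑ k : Fin 2, ‖g x j k‖ ^ 2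
      ≤ (eta F n K)⁻¹ ^ 2 * ∑ x : Site (F.P K) 0, (3 * a ^ 2 * ∑ μ : Fin (F.P K).d, ∑ j : Fin 2, ∑ k : Fin 2, ‖X ⟨x.unshift μ, μ⟩ j k‖ ^ 2) := by
    refine (Finset.sum_le_sum fun x _ => hsite x).trans (le_of_eq ?_)
    rw [Finset.mul_sum]
  have h3 : ∑ x : Site (F.P K) 0, (3 * a ^ 2 * ∑ μ : Fin (F.P K).d, ∑ j : Fin 2, ∑ k : Fin 2, ‖X ⟨x.unshift μ, μ⟩ j k‖ ^ 2)
      ≤ 3 * a ^ 2 * ∑ b : PBond (F.P K) 0, ∑ j : Fin 2, ∑ k : Fin 2, ‖X b j k‖ ^ 2 := by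
    rw [← Finset.mul_sum, hsum]
  have h4 : ‖toL2 F K c₀ X‖ ^ 2 = c₀ * ∑ b : PBond (F.P K) 0, ∑ j : Fin 2, ∑ k : Fin 2, ‖X b j k‖ ^ 2 := norm_sq_toL2 X
  rw [h4]
  exact chain_le_of_rows hc.le (by positivity) h1 h2 h3

/-- ★★ **THE `D`-COMMUTATOR ROW, GLOBAL** (✓`Prop7Lane2CutoffCommutators.norm_sq_DL2_smul_sub_le` at `S = univ`, norms on both sides):
`‖D_W(ζ•λ)~ − (ζ(b₋)•D_Wλ̃)~‖² ≤ 3·a²·η⁻²·‖λ̃‖²`. [cite: Balaban1985BackgroundPropagators, (3.3) p.391, (3.100) pp.413-414] -/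
theorem normSq_DL2_siteMul_sub_le (W : GaugeField (F.P K) 0 (Matrix.specialUnitaryGroup (Fin 2) ℂ)) (ζ : Site (F.P K) 0 → ℝ)
    (l : Site (F.P K) 0 → Matrix (Fin 2) (Fin 2) ℂ) {a : ℝ} (ha : ∀ (x : Site (F.P K) 0) (μ : Fin (F.P K).d), |ζ (x.shift μ) - ζ x| ≤ a) :
    ‖DL2 F n K c₀ W (toL2S F K c₀ (fun x => ζ x • l x))
        - toL2 F K c₀ (fun b => ζ b.src • (toL2 F K c₀).symm (DL2 F n K c₀ W (toL2S F K c₀ l)) b)‖ ^ 2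
      ≤ 3 * a ^ 2 * (eta F n K)⁻¹ ^ 2 * ‖toL2S F K c₀ l‖ ^ 2 := by
  have h := norm_sq_DL2_smul_sub_le F n K c₀ W ζ l Finset.univ ha (fun x μ _ => Finset.mem_univ _)
  exact h.trans_eq (by rw [norm_sq_toL2S])

end Member


/-! ## §C ★★★ The quadratic partition at scale `L^s` blocks, with its rows -/

section Package

variable (F : T3Family) (n K : ℕ) (c₀ : ℝ) [Fact (0 < c₀)]

omit [Fact (0 < c₀)] in
/-- `√8 + 8√8 = 18√2`. [folklore] -/
theorem sqrt_eight_add : Real.sqrt 8 + 8 * Real.sqrt 8 = 18 * Real.sqrt 2 := by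
  have h : Real.sqrt 8 = 2 * Real.sqrt 2 := by
    rw [show (8 : ℝ) = 2 * 2 * 2 by norm_num, Real.sqrt_mul (by norm_num), Real.sqrt_mul_self (by norm_num)]
  rw [h]; ring

omit [Fact (0 < c₀)] in
/-- ★★★ **THE QUADRATIC PARTITION OF UNITY AT SCALE `L^s` BLOCKS** (`n < K`, `s < m + n`): centres `Zc`, weights `χ_c = ζ_c∕√(Σζ²)` built on
✓`Prop7Lane2PartitionOfUnity.exists_partitionOfUnity`, with: values in `[0,1]`; `Σ_{c∈Zc} χ_c(x)² = 1`; `χ_c = 0` off `Zc`; support radius `< L^s·L^{K−n}` fine steps around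
`c` (sup-metric on coordinates); at most `8` alive at every site; per-fine-step `|χ_c(x ± e_μ) − χ_c(x)| ≤ 27√2∕(L^s·L^{K−n})`; family row
`Σ_c (χ_c(x ± e_μ) − χ_c(x))² ≤ 2880∕(L^s·L^{K−n})²`. [cite: Balaban1985BackgroundPropagators, (3.100) pp.413-414; Balaban1984PropagatorsII, §1] -/
theorem exists_sqPartition (s : ℕ) (hnK : n < K) (hs : s < F.m + n) :
    ∃ (Zc : Finset (Site (F.P K) 0)) (χ : Site (F.P K) 0 → Site (F.P K) 0 → ℝ),
      (∀ c x, 0 ≤ χ c x ∧ χ c x ≤ 1) ∧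
      (∀ x, ∑ c ∈ Zc, χ c x ^ 2 = 1) ∧
      (∀ c, c ∉ Zc → ∀ x, χ c x = 0) ∧
      (∀ c x, χ c x ≠ 0 → ∀ κ : Fin 3, min (x κ - c κ).val (c κ - x κ).val < F.L ^ s * F.L ^ (K - n)) ∧
      (∀ x, (Zc.filter (fun c => χ c x ≠ 0)).card ≤ 8) ∧
      (∀ c x (μ : Fin 3), |χ c (x.shift μ) - χ c x| ≤ 27 * Real.sqrt 2 / ((F.L : ℝ) ^ s * (F.L : ℝ) ^ (K - n)) ∧
        |χ c (x.unshift μ) - χ c x| ≤ 27 * Real.sqrt 2 / ((F.L : ℝ) ^ s * (F.L : ℝ) ^ (K - n))) ∧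
      (∀ x (μ : Fin 3), ∑ c ∈ Zc, (χ c (x.shift μ) - χ c x) ^ 2 ≤ 2880 / ((F.L : ℝ) ^ s * (F.L : ℝ) ^ (K - n)) ^ 2 ∧
        ∑ c ∈ Zc, (χ c (x.unshift μ) - χ c x) ^ 2 ≤ 2880 / ((F.L : ℝ) ^ s * (F.L : ℝ) ^ (K - n)) ^ 2) := by
  classical
  obtain ⟨Z, ζ, h01, hsum1, hoff, hsupp, hcard, hstep, -⟩ := exists_partitionOfUnity F n K s hnK hs
  -- letters
  have hL : (0 : ℝ) < F.L := by have := F.hL.2; exact_mod_cast (by omega : 0 < F.L)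
  set M : ℝ := (F.L : ℝ) ^ s * (F.L : ℝ) ^ (K - n) with hM
  have hM0 : 0 < M := by positivity
  set a : ℝ := 3 / 2 / M with ha
  have ha0 : 0 ≤ a := by positivity
  -- `N(x) = Σ ζ² ∈ [1/8, 1]`
  have hN8 : ∀ x, (8 : ℝ)⁻¹ ≤ ∑ c ∈ Z, ζ c x ^ 2 := by
    intro x
    have h := one_le_card_mul_sum_sq Z (fun c => ζ c x) (hsum1 x) (hcard x)
    simp only [Nat.cast_ofNat] at h
    rw [inv_le_iff_one_le_mul₀ (by norm_num)]; linarith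
  have hN8' : ∀ x, ((8 : ℕ) : ℝ)⁻¹ ≤ ∑ c ∈ Z, ζ c x ^ 2 := fun x => by simpa only [Nat.cast_ofNat] using hN8 x
  have hNpos : ∀ x, 0 < ∑ c ∈ Z, ζ c x ^ 2 := fun x => lt_of_lt_of_le (by norm_num) (hN8 x)
  have hle : ∀ c x, ζ c x ^ 2 ≤ ∑ c' ∈ Z, ζ c' x ^ 2 := by
    intro c x
    by_cases hc : c ∈ Z
    · exact sq_le_sum_sq Z (fun c' => ζ c' x) hc
    · rw [hoff c hc x, zero_pow two_ne_zero]; exact (hNpos x).le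
  -- the alive-count rows in the shape §A wants
  have hcardA : ∀ x, (Z.filter fun c => (fun c => ζ c x) c ≠ 0).card ≤ 8 := hcard
  have hNN : ∀ x x', (∀ c ∈ Z, |ζ c x' - ζ c x| ≤ a) → |∑ c ∈ Z, ζ c x ^ 2 - ∑ c ∈ Z, ζ c x' ^ 2| ≤ 2 * a := fun x x' h =>
    abs_sum_sq_sub_sum_sq_le Z (fun c => ζ c x) (fun c => ζ c x') (fun c _ => (h01 c x).1) (fun c _ => (h01 c x').1) (hsum1 x) (hsum1 x') h
  -- per-index and family rows between two sites one fine step apart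
  have hidx : ∀ c x x', (∀ c ∈ Z, |ζ c x' - ζ c x| ≤ a) → |ζ c x' - ζ c x| ≤ a →
      |ζ c x' / Real.sqrt (∑ c' ∈ Z, ζ c' x' ^ 2) - ζ c x / Real.sqrt (∑ c' ∈ Z, ζ c' x ^ 2)| ≤ 27 * Real.sqrt 2 / M := by
    intro c x x' hall hc
    have h := abs_div_sqrt_sub_div_sqrt_le (k := 8) (by norm_num) (h01 c x) hc (hN8' x) (hN8' x') (hNN x x' hall)
    simp only [Nat.cast_ofNat] at h
    refine h.trans (le_of_eq ?_)
    rw [sqrt_eight_add, ha]; ring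
  have hfam : ∀ x x', (∀ c ∈ Z, |ζ c x' - ζ c x| ≤ a) →
      ∑ c ∈ Z, (ζ c x' / Real.sqrt (∑ c' ∈ Z, ζ c' x' ^ 2) - ζ c x / Real.sqrt (∑ c' ∈ Z, ζ c' x ^ 2)) ^ 2 ≤ 2880 / M ^ 2 := by
    intro x x' hall
    have h := sum_sq_div_sqrt_sub_div_sqrt_le Z (fun c => ζ c x) (fun c => ζ c x') (k := 8) (by norm_num)
      (fun c _ => h01 c x) (fun c _ => h01 c x') (hsum1 x) (hsum1 x') (hcardA x) (hcardA x') hall rfl rfl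
    simp only [Nat.cast_ofNat] at h
    refine h.trans (le_of_eq ?_)
    rw [ha]; field_simp; norm_num
  refine ⟨Z, fun c x => ζ c x / Real.sqrt (∑ c' ∈ Z, ζ c' x ^ 2), fun c x => ?_, fun x => ?_, fun c hc x => ?_, fun c x hx => ?_, fun x => ?_,
    fun c x μ => ?_, fun x μ => ?_⟩
  · exact div_sqrt_mem_unitInterval (h01 c x).1 (hNpos x) (hle c x)
  · exact sum_div_sqrt_sq_eq_one Z (fun c => ζ c x) (hNpos x) rfl
  · show ζ c x / _ = 0
    rw [hoff c hc x, zero_div]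
  · refine hsupp c x fun h0 => hx ?_
    show ζ c x / _ = 0
    rw [h0, zero_div]
  · refine le_trans (Finset.card_le_card fun c hc => ?_) (hcard x)
    rw [Finset.mem_filter] at hc ⊢
    refine ⟨hc.1, fun h0 => hc.2 ?_⟩
    show ζ c x / _ = 0
    rw [h0, zero_div]
  · exact ⟨hidx c x (x.shift μ) (fun c _ => (hstep c x μ).1) (hstep c x μ).1,
      hidx c x (x.unshift μ) (fun c _ => (hstep c x μ).2) (hstep c x μ).2⟩
  · exact ⟨hfam x (x.shift μ) fun c _ => (hstep c x μ).1, hfam x (x.unshift μ) fun c _ => (hstep c x μ).2⟩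

/-- ★ **THE CURRENCY**: with `ℓ = 27√2∕(L^s·L^{K−n})` and `η·L^{K−n} = 1`, `3ℓ²η⁻² = 4374·(L^s)⁻²` — K-free. [cite: Balaban1985BackgroundPropagators, (3.100) pp.413-414] -/
theorem three_mul_sq_step_mul_inv_eta_sq (s : ℕ) :
    3 * (27 * Real.sqrt 2 / ((F.L : ℝ) ^ s * (F.L : ℝ) ^ (K - n))) ^ 2 * (eta F n K)⁻¹ ^ 2 = 4374 * (((F.L : ℝ) ^ s) ^ 2)⁻¹ := by
  have hL : (0 : ℝ) < F.L := by have := F.hL.2; exact_mod_cast (by omega : 0 < F.L)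
  have hη : (eta F n K)⁻¹ = (F.L : ℝ) ^ (K - n) := by rw [T3SectALandauChart.eta, ← inv_pow, inv_inv]
  have h2 : Real.sqrt 2 ^ 2 = 2 := Real.sq_sqrt (by norm_num)
  have hLs : (F.L : ℝ) ^ s ≠ 0 := by positivity
  have hLK : (F.L : ℝ) ^ (K - n) ≠ 0 := by positivity
  rw [hη, div_pow, mul_pow, mul_pow, h2]
  field_simp
  norm_num

/-- ★★ **THE COMMUTATOR ROWS FOR ANY OPERATOR PAIR WITH THE (Z2) READINGS** of a weight `χ` with per-fine-step bound `ℓ` (✓`Prop7Lane2CutoffOps.exists_cutoffOps_norm_le`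
supplies such `Zs, Zb`): `‖D_W(Zs φ) − Zb(D_W φ)‖² ≤ 3ℓ²η⁻²‖φ‖²` and `‖D*_W(Zb f) − Zs(D*_W f)‖² ≤ 3ℓ²η⁻²‖f‖²`.
[cite: Balaban1985BackgroundPropagators, (3.3) p.391, (3.8) p.392, (3.100) pp.413-414] -/
theorem normSq_comm_rows_of_readings (W : GaugeField (F.P K) 0 (Matrix.specialUnitaryGroup (Fin 2) ℂ)) (χ : Site (F.P K) 0 → ℝ) {ℓ : ℝ}
    (hχ : ∀ (x : Site (F.P K) 0) (μ : Fin (F.P K).d), |χ (x.shift μ) - χ x| ≤ ℓ)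
    (Zs : B11Eq103H1Complex.SiteL2K ℂ 3 (Prop7SectET3Transport.periodsT3 F K) c₀ W₂ →ₗ[ℂ]
      B11Eq103H1Complex.SiteL2K ℂ 3 (Prop7SectET3Transport.periodsT3 F K) c₀ W₂)
    (Zb : B11Eq103H1Complex.BondL2K ℂ 3 (Prop7SectET3Transport.periodsT3 F K) c₀ W₂ →ₗ[ℂ]
      B11Eq103H1Complex.BondL2K ℂ 3 (Prop7SectET3Transport.periodsT3 F K) c₀ W₂)
    (hZs : ∀ φ x, (toL2S F K c₀).symm (Zs φ) x = χ x • (toL2S F K c₀).symm φ x)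
    (hZb : ∀ f b, (toL2 F K c₀).symm (Zb f) b = χ b.src • (toL2 F K c₀).symm f b) :
    (∀ φ, ‖DL2 F n K c₀ W (Zs φ) - Zb (DL2 F n K c₀ W φ)‖ ^ 2 ≤ 3 * ℓ ^ 2 * (eta F n K)⁻¹ ^ 2 * ‖φ‖ ^ 2) ∧
    (∀ f, ‖DstarL2 F n K c₀ W (Zb f) - Zs (DstarL2 F n K c₀ W f)‖ ^ 2 ≤ 3 * ℓ ^ 2 * (eta F n K)⁻¹ ^ 2 * ‖f‖ ^ 2) := by
  -- the readings as vector identities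
  have eS : ∀ φ, Zs φ = toL2S F K c₀ (fun x => χ x • (toL2S F K c₀).symm φ x) := fun φ => by
    apply (toL2S F K c₀).symm.injective
    rw [LinearEquiv.symm_apply_apply]; funext x; exact hZs φ x
  have eB : ∀ f, Zb f = toL2 F K c₀ (fun b => χ b.src • (toL2 F K c₀).symm f b) := fun f => by
    apply (toL2 F K c₀).symm.injective
    rw [LinearEquiv.symm_apply_apply]; funext b; exact hZb f b
  refine ⟨fun φ => ?_, fun f => ?_⟩
  · obtain ⟨l, rfl⟩ : ∃ l, φ = toL2S F K c₀ l := ⟨(toL2S F K c₀).symm φ, ((toL2S F K c₀).apply_symm_apply φ).symm⟩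
    have e1 : Zs (toL2S F K c₀ l) = toL2S F K c₀ (fun x => χ x • l x) := by
      rw [eS]; congr 1; funext x; rw [LinearEquiv.symm_apply_apply]
    rw [e1, eB]
    exact normSq_DL2_siteMul_sub_le F W χ l hχ
  · obtain ⟨X, rfl⟩ : ∃ X, f = toL2 F K c₀ X := ⟨(toL2 F K c₀).symm f, ((toL2 F K c₀).apply_symm_apply f).symm⟩
    have e1 : Zb (toL2 F K c₀ X) = toL2 F K c₀ (fun b => χ b.src • X b) := by
      rw [eB]; congr 1; funext b; rw [LinearEquiv.symm_apply_apply]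
    rw [e1, eS]
    exact normSq_DstarL2_srcMul_sub_le F W χ X hχ

end Package

end Summit.QuantumFields.YangMills.Theorems.Prop7LODCutoffLetters

end
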